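import Summits.QuantumFields.BalabanUV.T4Continuum.Support.NE7EffectiveFormKernelFlat
import Summits.QuantumFields.BalabanUV.T4Continuum.Support.NE7NearStabiliserTorus
import HarnessLib

/-!
# NE7CoarseCurlEnergyFlatQuant — THE QUANTITATIVE FORM OF THE FIRST ESTIMATE: COARSE MAXWELL ENERGY OF THE LINEARISED AVERAGE ≤ C·FINE MAXWELL ENERGY, AND THE LOWER BOUND
# `⟨v, Δ₁ v⟩ ≥ c·Σ_P ‖curl_1 ṽ(P)‖²_{nHS}` FOR THE ONE-STEP EFFECTIVE QUADRATIC FORM AT THE FLAT DATUM (ROAD-G115 §10 (ix) executed)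

`d = 4`, one averaging step, flat configuration, `M = L·N`.  The sup bound `γ` of ✓ `NE7CoarseCurlEnergyFlat.coarse_curl_energy_le` is at most the `ℓ²` curl norm (periodicity of the
flat dressed curl of a periodic field, `site_eq_wrap`), whence (**`coarse_curl_energy_le_quant`**)
  `Σ_{P∈perWin N} nhsNormSq(curl_1 (Q′X)̃ P) ≤ (1 + wallConst 4 L·√(M⁴·4·#planes)·4·card n) · Σ_{p∈perWin M} nhsNormSq(curl_1 X̃ p)`
for every skew `X ∈ skewSub M`, and, with ✓ `NE7MinimiserDerivativeFlat` (`⟨v,Δv⟩ = w·Σ_p nhsNormSq(curl_1 (Hv)̃ p)`, `Q′(Hv) = v`), **`effectiveForm_ge_coarse_curl_flat`**: for `L ≥ 2`,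
`0 < ε ≤ ε₀`, `N ≥ 1` and every `v ∈ skewSub N`,
  `D²(minAct∘chart_1)(0)[v, v] ≥ (w ∕ (1 + wallConst 4 L·√((LN)⁴·4·#planes)·4·card n)) · Σ_{P∈perWin N} nhsNormSq(curl_1 ṽ P)`, `w = stepWt⁻¹`
— THE ONE-STEP EFFECTIVE ACTION AT THE FLAT BACKGROUND DOMINATES THE COARSE MAXWELL FORM: quantitative positivity of Bałaban's variational `Δ₁` transversally to closed fields.
Cell `pub-balaban`, rung (B)+1 sub-cell t4, lineage `b2b-balaban-t4-ne7-p1` (CRUX PROVER NE7 #1 = OWNER of BINDER row NE7), generation 115.  Memo `t4/b2b-balaban-t4-ne7-p1-g115/ROAD-G115.md` §10.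
WHAT ([folklore]; 0 def, 0 sorry).  HONEST FRAMING (page 1): ONE step, FLAT datum; the constant is VOLUME-DEPENDENT (`√((LN)⁴…)`, `card n`) — NOT Bałaban's uniform bound; OUR minimisers
(B11 (8) with `sfClass`); nothing of Bałaban's asserted; NOT NE7 as a spine node, NOT NE3; spine 0∕9; NOT infinite volume, NOT mass gap, NOT BetaPertH, NOT Clay.
-/

set_option autoImplicit false

open scoped BigOperators Matrix Matrix.Norms.L2Operator Topology
open NormedSpace Finset Set Filter Metric

namespace Summit.QuantumFields.BalabanUV.T4Continuum.NE7CoarseCurlEnergyFlatQuant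

open Literature.MathematicalPhysics.QuantumFieldTheory.Balaban1983to89
open B7Prop1Explicit B7Prop2Explicit
open T4AveragingDeficitWall (curl curlAt curlSq Ad)
open T4AveragingDeficitWallBoundary (periodBox)
open AveragingDeficitPeriodicCounting (IsPeriodicDir)
open AveragingDeficitTorusChart (TDir chart chartDir redN isPeriodicDir_chartDir)
open AveragingDeficitTwoLevelPrep (skewSub)
open AveragingDeficitMultiLevelPrep (tower levelQ')
open AveragingDeficitDerivWallProof (wallConst wallConst_nonneg)
open MinimalActionLevels (perWin stepWt stepWt_pos)
open MinimalActionSandwich (minAct)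
open MinimalActionRate (sfClass)
open MinimalActionWitness (flatCfg)
open MatrixNorms (nhsNormSq nhsNormSq_nonneg opNorm_sq_le_card_mul_nhsNormSq)
open NE3FlatHessianCurl (flatCfg_eq_one)
open NE7NearStabiliserTorus (site_eq_wrap)
open NE7BoxPoincareMatrix (boxVec_mem_periodBox)
open NE7CoarseCurlEnergyFlat (coarse_curl_energy_le)
open NE7MinimiserDerivativeFlat (minimiser_derivative_flat)

noncomputable section

variable {n : Type} [Fintype n] [DecidableEq n]

/-- At the flat configuration `Ad` is trivial. [folklore] -/
theorem Ad_flat (z : Site 4) (μ : Fin 4) (A : Matrix n n ℂ) : Ad ((flatCfg : Site 4 → Fin 4 → (Matrix n n ℂ)ˣ) z μ) A = A := by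
  simp only [Ad, flatCfg_eq_one, Units.val_one, inv_one, one_mul, mul_one]

/-- The flat dressed curl, explicitly. [folklore] -/
theorem curlAt_flat (ψ : Site 4 → Fin 4 → Matrix n n ℂ) (z : Site 4) (μ ν : Fin 4) :
    curlAt (flatCfg : Site 4 → Fin 4 → (Matrix n n ℂ)ˣ) ψ z μ ν = ψ z μ + ψ (z + e μ) ν - ψ (z + e ν) μ - ψ z ν := by
  simp only [curlAt, Ad, flatCfg_eq_one, Units.val_one, inv_one, one_mul, mul_one]

/-- The flat dressed curl is antisymmetric in the two directions. [folklore] -/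
theorem curlAt_flat_swap (ψ : Site 4 → Fin 4 → Matrix n n ℂ) (z : Site 4) (μ ν : Fin 4) :
    curlAt (flatCfg : Site 4 → Fin 4 → (Matrix n n ℂ)ˣ) ψ z ν μ = -curlAt (flatCfg : Site 4 → Fin 4 → (Matrix n n ℂ)ˣ) ψ z μ ν := by
  rw [curlAt_flat, curlAt_flat]; abel

/-- Periodicity of the flat dressed curl of a periodic field. [folklore] -/
theorem curlAt_flat_add_period {ψ : Site 4 → Fin 4 → Matrix n n ℂ} {P : ℤ} (hψ : IsPeriodicDir ψ P) (z : Site 4) (i μ ν : Fin 4) :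
    curlAt (flatCfg : Site 4 → Fin 4 → (Matrix n n ℂ)ˣ) ψ (z + P • e i) μ ν = curlAt (flatCfg : Site 4 → Fin 4 → (Matrix n n ℂ)ˣ) ψ z μ ν := by
  rw [curlAt_flat, curlAt_flat, add_right_comm z _ (e μ), add_right_comm z _ (e ν), hψ z i μ, hψ (z + e μ) i ν, hψ (z + e ν) i μ, hψ z i ν]

/-- **THE SUP OF THE FLAT DRESSED CURL OF A PERIODIC FIELD IS AT MOST ITS `ℓ²` NORM ON THE PERIOD BOX.** [folklore] -/
theorem norm_curlAt_flat_le_sqrt_curlSq {M : ℕ} [NeZero M] (X : ↥(skewSub 4 n M)) (z : Site 4) {μ ν : Fin 4} (hμν : μ ≠ ν) :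
    ‖curlAt (flatCfg : Site 4 → Fin 4 → (Matrix n n ℂ)ˣ) (chartDir (ContinuousLinearMap.id ℝ (Matrix n n ℂ)) M (X : TDir 4 n M)) z μ ν‖
      ≤ Real.sqrt (curlSq (flatCfg : Site 4 → Fin 4 → (Matrix n n ℂ)ˣ) (chartDir (ContinuousLinearMap.id ℝ (Matrix n n ℂ)) M (X : TDir 4 n M)) (periodBox (d := 4) M)) := by
  set ψ := chartDir (ContinuousLinearMap.id ℝ (Matrix n n ℂ)) M (X : TDir 4 n M) with hψ
  have hper : IsPeriodicDir ψ (M : ℤ) := isPeriodicDir_chartDir _ M _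
  -- ordered pairs: reduce to `μ < ν`
  have key : ∀ {a b : Fin 4} (h : a < b), ‖curlAt (flatCfg : Site 4 → Fin 4 → (Matrix n n ℂ)ˣ) ψ z a b‖
      ≤ Real.sqrt (curlSq (flatCfg : Site 4 → Fin 4 → (Matrix n n ℂ)ˣ) ψ (periodBox (d := 4) M)) := by
    intro a b h
    set π : T4AveragingDeficitWall.Plane 4 := ⟨(a, b), h⟩ with hπ
    have hwrap := site_eq_wrap (N := M) (u := fun y : Site 4 => curl (flatCfg : Site 4 → Fin 4 → (Matrix n n ℂ)ˣ) ψ (y, π))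
      (fun y i => curlAt_flat_add_period hper y i a b) z
    have hz : boxVec M (redN M z) ∈ periodBox (d := 4) M := boxVec_mem_periodBox _
    have e1 : curlAt (flatCfg : Site 4 → Fin 4 → (Matrix n n ℂ)ˣ) ψ z a b = curl (flatCfg : Site 4 → Fin 4 → (Matrix n n ℂ)ˣ) ψ (boxVec M (redN M z), π) := hwrap
    rw [e1, ← Real.sqrt_sq (norm_nonneg _)]
    refine Real.sqrt_le_sqrt ?_
    unfold curlSq
    have h1 : ‖curl (flatCfg : Site 4 → Fin 4 → (Matrix n n ℂ)ˣ) ψ (boxVec M (redN M z), π)‖ ^ 2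
        ≤ ∑ π' : T4AveragingDeficitWall.Plane 4, ‖curl (flatCfg : Site 4 → Fin 4 → (Matrix n n ℂ)ˣ) ψ (boxVec M (redN M z), π')‖ ^ 2 :=
      Finset.single_le_sum (f := fun π' => ‖curl (flatCfg : Site 4 → Fin 4 → (Matrix n n ℂ)ˣ) ψ (boxVec M (redN M z), π')‖ ^ 2) (fun _ _ => by positivity) (Finset.mem_univ π)
    exact h1.trans (Finset.single_le_sum (f := fun y => ∑ π' : T4AveragingDeficitWall.Plane 4, ‖curl (flatCfg : Site 4 → Fin 4 → (Matrix n n ℂ)ˣ) ψ (y, π')‖ ^ 2)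
      (fun _ _ => Finset.sum_nonneg fun _ _ => by positivity) hz)
  rcases lt_or_gt_of_ne hμν with h | h
  · exact key h
  · rw [← neg_neg (curlAt _ ψ z μ ν), ← curlAt_flat_swap, norm_neg]; exact key h

/-- `curlSq ≤ card n · Σ_{perWin} nhsNormSq (curl)` (operator norm against the normalised Hilbert–Schmidt square). [folklore] -/
theorem curlSq_le_card_mul_sum {M : ℕ} (V : Site 4 → Fin 4 → (Matrix n n ℂ)ˣ) (ψ : Site 4 → Fin 4 → Matrix n n ℂ) :
    curlSq V ψ (periodBox (d := 4) M) ≤ (Fintype.card n : ℝ) * ∑ p ∈ perWin 4 M, nhsNormSq (curl V ψ p) := by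
  unfold curlSq perWin
  rw [Finset.sum_product, Finset.mul_sum]
  refine Finset.sum_le_sum fun z _ => ?_
  rw [Finset.mul_sum]
  exact Finset.sum_le_sum fun π _ => opNorm_sq_le_card_mul_nhsNormSq _

/-- **COARSE MAXWELL ENERGY OF THE LINEARISED AVERAGE ≤ C·FINE MAXWELL ENERGY** (flat, one step; see the module docstring). [folklore] -/
theorem coarse_curl_energy_le_quant [Nonempty n] {L : ℕ} [NeZero L] (hL : 1 ≤ L) (N : ℕ) [NeZero N] (hN : 1 ≤ N) (X : ↥(skewSub 4 n (L * N))) :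
    haveI : NeZero (L * N) := ⟨Nat.mul_ne_zero (NeZero.ne L) (NeZero.ne N)⟩
    ∑ P ∈ perWin 4 N, nhsNormSq (curl (flatCfg : Site 4 → Fin 4 → (Matrix n n ℂ)ˣ)
        (chartDir (ContinuousLinearMap.id ℝ (Matrix n n ℂ)) N
          ((levelQ' L N 0 (flatCfg : Site 4 → Fin 4 → (Matrix n n ℂ)ˣ) (X : TDir 4 n (L * N)) : ↥(skewSub 4 n N)) : TDir 4 n N)) P)
      ≤ (1 + wallConst 4 L * Real.sqrt ((((L * N : ℕ) : ℝ)) ^ 4 * (4 * Fintype.card (T4AveragingDeficitWall.Plane 4))) * 4 * Fintype.card n)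
        * ∑ p ∈ perWin 4 (L * N), nhsNormSq (curl (flatCfg : Site 4 → Fin 4 → (Matrix n n ℂ)ˣ)
            (chartDir (ContinuousLinearMap.id ℝ (Matrix n n ℂ)) (L * N) (X : TDir 4 n (L * N))) p) := by
  haveI : NeZero (L * N) := ⟨Nat.mul_ne_zero (NeZero.ne L) (NeZero.ne N)⟩
  set S := curlSq (flatCfg : Site 4 → Fin 4 → (Matrix n n ℂ)ˣ) (chartDir (ContinuousLinearMap.id ℝ (Matrix n n ℂ)) (L * N) (X : TDir 4 n (L * N))) (periodBox (d := 4) (L * N)) with hS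
  set E := ∑ p ∈ perWin 4 (L * N), nhsNormSq (curl (flatCfg : Site 4 → Fin 4 → (Matrix n n ℂ)ˣ)
    (chartDir (ContinuousLinearMap.id ℝ (Matrix n n ℂ)) (L * N) (X : TDir 4 n (L * N))) p) with hE
  set C := wallConst 4 L * Real.sqrt ((((L * N : ℕ) : ℝ)) ^ 4 * (4 * Fintype.card (T4AveragingDeficitWall.Plane 4))) * 4 with hC
  have hC0 : 0 ≤ C := by rw [hC]; have := wallConst_nonneg 4 L; positivity
  have hS0 : 0 ≤ S := by rw [hS]; unfold curlSq; exact Finset.sum_nonneg fun _ _ => Finset.sum_nonneg fun _ _ => by positivity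
  have hE0 : 0 ≤ E := Finset.sum_nonneg fun _ _ => nhsNormSq_nonneg _
  have h := coarse_curl_energy_le (n := n) hL N hN X (γ := Real.sqrt S) (Real.sqrt_nonneg _) (fun z μ ν hμν => norm_curlAt_flat_le_sqrt_curlSq X z hμν)
  have hSS : Real.sqrt S * Real.sqrt S = S := Real.mul_self_sqrt hS0
  have hSE : S ≤ (Fintype.card n : ℝ) * E := curlSq_le_card_mul_sum _ _
  calc _ ≤ E + C * Real.sqrt S * Real.sqrt S := by rw [hC]; convert h using 1; ring
    _ = E + C * S := by rw [mul_assoc, hSS]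
    _ ≤ E + C * ((Fintype.card n : ℝ) * E) := by gcongr
    _ = (1 + C * Fintype.card n) * E := by ring

set_option maxHeartbeats 1600000 in
/-- **THE ONE-STEP EFFECTIVE QUADRATIC FORM AT THE FLAT DATUM DOMINATES THE COARSE MAXWELL FORM** (see the module docstring). [folklore] -/
theorem effectiveForm_ge_coarse_curl_flat [Nonempty n] {L : ℕ} [NeZero L] (hL : 2 ≤ L) :
    ∃ ε₀ : ℝ, 0 < ε₀ ∧ ∀ ε : ℝ, 0 < ε → ε ≤ ε₀ → ∀ (N : ℕ) [NeZero N], 1 ≤ N → ∀ v : ↥(skewSub 4 n N),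
      ((stepWt 4 L)⁻¹) ^ (0 + 1) / (1 + wallConst 4 L * Real.sqrt ((((L * N : ℕ) : ℝ)) ^ 4 * (4 * Fintype.card (T4AveragingDeficitWall.Plane 4))) * 4 * Fintype.card n)
          * ∑ P ∈ perWin 4 N, nhsNormSq (curl (flatCfg : Site 4 → Fin 4 → (Matrix n n ℂ)ˣ) (chartDir (ContinuousLinearMap.id ℝ (Matrix n n ℂ)) N (v : TDir 4 n N)) P)
        ≤ fderiv ℝ (fderiv ℝ (fun y : ↥(skewSub 4 n N) => minAct 4 (sfClass 4 L N ε) L N (0 + 1)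
            (chart (ContinuousLinearMap.id ℝ (Matrix n n ℂ)) N (flatCfg : Site 4 → Fin 4 → (Matrix n n ℂ)ˣ) (y : TDir 4 n N)))) 0 v v := by
  have hL1 : 1 ≤ L := by omega
  obtain ⟨ε₀, hε₀, H⟩ := minimiser_derivative_flat (n := n) hL
  refine ⟨ε₀, hε₀, fun ε hε hεle N _ hN v => ?_⟩
  obtain ⟨Ψ, -, -, -, hH⟩ := H ε hε hεle N hN 0
  obtain ⟨hQ, -, hc⟩ := hH v
  haveI : NeZero (L * N) := ⟨Nat.mul_ne_zero (NeZero.ne L) (NeZero.ne N)⟩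
  obtain ⟨Xv, hXv⟩ : ∃ Xv : TDir 4 n (L * N), Xv = ((fderiv ℝ Ψ 0 v : ↥(skewSub 4 n (L * tower L N 0))) : TDir 4 n (L * tower L N 0)) := ⟨_, rfl⟩
  rw [← hXv] at hQ hc
  have hXmem : Xv ∈ skewSub 4 n (L * N) := by rw [hXv]; exact (fderiv ℝ Ψ 0 v).2
  set XH : ↥(skewSub 4 n (L * N)) := ⟨Xv, hXmem⟩ with hXH
  have hXHval : ((XH : ↥(skewSub 4 n (L * N))) : TDir 4 n (L * N)) = Xv := rfl
  have hcd : chartDir (ContinuousLinearMap.id ℝ (Matrix n n ℂ)) (L * tower L N 0) Xv = chartDir (ContinuousLinearMap.id ℝ (Matrix n n ℂ)) (L * N) Xv := rfl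
  have hper : N * L ^ (0 + 1) = L * N := by ring
  rw [hper, hcd] at hc
  set w : ℝ := ((stepWt 4 L)⁻¹) ^ (0 + 1) with hw
  have hw0 : 0 < w := pow_pos (inv_pos.mpr (stepWt_pos (d := 4) L hL1)) _
  set C' : ℝ := 1 + wallConst 4 L * Real.sqrt ((((L * N : ℕ) : ℝ)) ^ 4 * (4 * Fintype.card (T4AveragingDeficitWall.Plane 4))) * 4 * Fintype.card n with hC'
  have hC'0 : 0 < C' := by rw [hC']; have := wallConst_nonneg 4 L; positivity
  have hest := coarse_curl_energy_le_quant (n := n) hL1 N hN XH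
  rw [hXHval, hQ] at hest
  rw [hc, div_mul_eq_mul_div, div_le_iff₀ hC'0]
  calc w * ∑ P ∈ perWin 4 N, nhsNormSq (curl (flatCfg : Site 4 → Fin 4 → (Matrix n n ℂ)ˣ) (chartDir (ContinuousLinearMap.id ℝ (Matrix n n ℂ)) N (v : TDir 4 n N)) P)
      ≤ w * (C' * ∑ p ∈ perWin 4 (L * N), nhsNormSq (curl (flatCfg : Site 4 → Fin 4 → (Matrix n n ℂ)ˣ) (chartDir (ContinuousLinearMap.id ℝ (Matrix n n ℂ)) (L * N) Xv) p)) :=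
        mul_le_mul_of_nonneg_left hest hw0.le
    _ = (w * ∑ p ∈ perWin 4 (L * N), nhsNormSq (curl (flatCfg : Site 4 → Fin 4 → (Matrix n n ℂ)ˣ) (chartDir (ContinuousLinearMap.id ℝ (Matrix n n ℂ)) (L * N) Xv) p)) * C' := by ring

end

end Summit.QuantumFields.BalabanUV.T4Continuum.NE7CoarseCurlEnergyFlatQuant
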